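import Literature.Computability.Complexity.HardcoreInapproximabilitySecondMomentBound
import HarnessLib

/-!
# The continuum rate of the Mossel–Weitz–Wormald second-moment ratio (hard-core bipartite gadget)

For the random bipartite `d`-regular gadget of Mossel–Weitz–Wormald / Sly, the summand of
`E[Z_{α,β}²]/(E Z_{α,β})²` indexed by the overlaps `(γ, δ, ε)` has exponential rate
`f(α,β;γ,δ,ε) = slyFA + d (Ψ₂ - 2Ψ₁)` (`slyRate`).  This file proves, calculus-free:

* `slyRate_star` — MWW Lemma 5.2: `f = 0` at the product point `c* = (α², β², α(1-α-β))`;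
* `slyLin_eq_zero` — MWW Lemma 5.1: `c*` is a stationary point;
* `slyQuad_eq` — the quadratic part of `f` at `c*` is MWW's Hessian form `slyQ` (`½ hᵀ H_f h`);
* `abs_slyRate_sub_slyQ_le` — the second-order expansion with an explicit cubic remainder
  `|f(c*+h) - slyQ(h)| ≤ 12(4+7d) s³/m⁴` for `s = |h₁|+|h₂|+|h₃| ≤ m²/2`, `m = min(α,β,1-α-β)`,
  via an elementary Taylor bound for `u ↦ u log u` (`abs_mul_log_taylor_le`).

## References
* [MosselWeitzWormald2008] E. Mossel, D. Weitz, N. Wormald, *On the hardness of sampling independent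
  sets beyond the tree threshold*, PTRF 143 (2009), §3 (Prop. 3.1), §5 (Lemmas 5.1, 5.2, `H_f`), §6.
* [Sly2010] A. Sly, *Computational transition at the uniqueness threshold*, FOCS 2010 /
  arXiv:1005.5584, §3 (Lemma 3.5, Theorem 3.10: the second-moment input).
-/

namespace Literature.Computability.Complexity

open Real Finset

/-- **Binomial entropy rate**: `entB X Y = X log X - Y log Y - (X-Y) log (X-Y)`, so that
`log C(Xn, Yn) = n · entB X Y - ½ log(2πn Y(X-Y)/X) + O(1/(n min(Y, X-Y)))` (`= X · H(Y/X)`).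
[cite: MosselWeitzWormald2008, proof of Theorem 6.11 (the approximation of `C(bn, an)`)] -/
noncomputable def entB (X Y : ℝ) : ℝ := X * Real.log X - Y * Real.log Y - (X - Y) * Real.log (X - Y)

/-- **The hypergeometric part** of the rate of the second-moment ratio: the exponential rates of
`C(a,g)C(n-a,a-g)/C(n,a)` and `C(b,h)C(n-b,b-h)/C(n,b)` (pairs of configurations with overlaps
`γ = g/n`, `δ = h/n`). [cite: MosselWeitzWormald2008, §5 (the function `Φ₂`, first three lines)] -/
noncomputable def slyFA (α β γ δ : ℝ) : ℝ :=
  entB α γ + entB (1 - α) (α - γ) - entB 1 α + (entB β δ + entB (1 - β) (β - δ) - entB 1 β)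

/-- **The matching part** `Ψ₂(α,β,γ,δ,ε)` of Mossel–Weitz–Wormald: the exponential rate of the
probability that one uniform perfect matching is compatible with both configurations, in the
three-event form (common plus vertices into the free minus class; first-only plus vertices, `εn` of
them into the free class; second-only plus vertices). [cite: MosselWeitzWormald2008, §5 (the function `Ψ₂`: "the three lines correspond to the probability of the following three events")] -/
noncomputable def slyFB (α β γ δ ε : ℝ) : ℝ :=
  entB (1 - 2 * β + δ) γ - entB 1 γ +
    (entB (1 - 2 * β + δ - γ) ε + entB (β - δ) (α - γ - ε) - entB (1 - γ) (α - γ)) +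
    (entB (1 - β - γ - ε) (α - γ) - entB (1 - α) (α - γ))

/-- **`Ψ₁(α, β)`**: the rate of the probability `C(n-b,a)/C(n,a)` that one matching is compatible
with one configuration. [cite: MosselWeitzWormald2008, Proposition 3.1 (`Ψ₁ = (1-β)H(α/(1-β)) - H(α)`)] -/
noncomputable def slyPsi1 (α β : ℝ) : ℝ := entB (1 - β) α - entB 1 α

/-- **The rate `f = Γ/… ` of the summand of `E[Z²]/(EZ)²`** (MWW's `Φ₂ - 2Φ₁ = -Γ` up to the
`λ`-terms, which cancel): `f(α,β;γ,δ,ε) = fA + d (Ψ₂ - 2Ψ₁)`. [cite: MosselWeitzWormald2008, §5 eq. (for `Γ`), Lemmas 5.1–5.2] -/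
noncomputable def slyRate (d : ℕ) (α β γ δ ε : ℝ) : ℝ :=
  slyFA α β γ δ + d * (slyFB α β γ δ ε - 2 * slyPsi1 α β)

/-- Evaluating `entB` from the values of its three arguments and their logarithms. [folklore] -/
theorem entB_val {X Y x y z lx ly lz : ℝ} (hx : X = x) (hy : Y = y) (hz : X - Y = z)
    (hlx : Real.log x = lx) (hly : Real.log y = ly) (hlz : Real.log z = lz) :
    entB X Y = x * lx - y * ly - z * lz := by
  unfold entB; rw [hz, hx, hy, hlx, hly, hlz]

/-- **MWW Lemma 5.2**: the rate of the second-moment ratio vanishes at the product point,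
`f(α,β; α², β², α(1-α-β)) = 0` (`Γ(α,β,γ*,δ*,ε*) = 0`). [cite: MosselWeitzWormald2008, Lemma 5.2] -/
theorem slyRate_star (d : ℕ) {α β : ℝ} (hα : 0 < α) (hβ : 0 < β) (hαβ : α + β < 1) :
    slyRate d α β (α ^ 2) (β ^ 2) (α * (1 - α - β)) = 0 := by
  -- the seven logarithm atoms
  have h1α : 0 < 1 - α := by linarith
  have h1β : 0 < 1 - β := by linarith
  have hab : 0 < 1 - α - β := by linarith
  have hpa : 0 < 1 + α := by linarith
  have hpab : 0 < 1 + α - β := by linarith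
  set La := Real.log α with hLa
  set Lb := Real.log β with hLb
  set L1a := Real.log (1 - α) with hL1a
  set L1b := Real.log (1 - β) with hL1b
  set Lab := Real.log (1 - α - β) with hLab
  set Lpa := Real.log (1 + α) with hLpa
  set Lpab := Real.log (1 + α - β) with hLpab
  have l1 : Real.log (1 : ℝ) = 0 := Real.log_one
  have lαα : Real.log (α ^ 2) = 2 * La := by rw [Real.log_pow]; norm_num [hLa]
  have lββ : Real.log (β ^ 2) = 2 * Lb := by rw [Real.log_pow]; norm_num [hLb]
  have lα1α : Real.log (α * (1 - α)) = La + L1a := Real.log_mul hα.ne' h1α.ne'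
  have lβ1β : Real.log (β * (1 - β)) = Lb + L1b := Real.log_mul hβ.ne' h1β.ne'
  have l1α2 : Real.log ((1 - α) ^ 2) = 2 * L1a := by rw [Real.log_pow]; norm_num [hL1a]
  have l1β2 : Real.log ((1 - β) ^ 2) = 2 * L1b := by rw [Real.log_pow]; norm_num [hL1b]
  have labp : Real.log ((1 - α - β) * (1 + α - β)) = Lab + Lpab := Real.log_mul hab.ne' hpab.ne'
  have l1apa : Real.log ((1 - α) * (1 + α)) = L1a + Lpa := Real.log_mul h1α.ne' hpa.ne'
  have lαab : Real.log (α * (1 - α - β)) = La + Lab := Real.log_mul hα.ne' hab.ne'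
  have lab1b : Real.log ((1 - α - β) * (1 - β)) = Lab + L1b := Real.log_mul hab.ne' h1β.ne'
  have lαβ : Real.log (α * β) = La + Lb := Real.log_mul hα.ne' hβ.ne'
  have lβab : Real.log (β * (1 - α - β)) = Lb + Lab := Real.log_mul hβ.ne' hab.ne'
  have l1a1b : Real.log ((1 - α) * (1 - β)) = L1a + L1b := Real.log_mul h1α.ne' h1β.ne'
  have l1aab : Real.log ((1 - α) * (1 - α - β)) = L1a + Lab := Real.log_mul h1α.ne' hab.ne'
  -- the fifteen `entB` terms
  have T1 := entB_val (X := α) (Y := α ^ 2) rfl rfl (by ring : α - α ^ 2 = α * (1 - α)) hLa.symm lαα lα1α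
  have T2 := entB_val (X := 1 - α) (Y := α - α ^ 2) rfl (by ring : α - α ^ 2 = α * (1 - α))
    (by ring : (1 - α) - (α - α ^ 2) = (1 - α) ^ 2) hL1a.symm lα1α l1α2
  have T3 := entB_val (X := (1 : ℝ)) (Y := α) rfl rfl (by ring : (1 : ℝ) - α = 1 - α) l1 hLa.symm hL1a.symm
  have T4 := entB_val (X := β) (Y := β ^ 2) rfl rfl (by ring : β - β ^ 2 = β * (1 - β)) hLb.symm lββ lβ1β
  have T5 := entB_val (X := 1 - β) (Y := β - β ^ 2) rfl (by ring : β - β ^ 2 = β * (1 - β))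
    (by ring : (1 - β) - (β - β ^ 2) = (1 - β) ^ 2) hL1b.symm lβ1β l1β2
  have T6 := entB_val (X := (1 : ℝ)) (Y := β) rfl rfl (by ring : (1 : ℝ) - β = 1 - β) l1 hLb.symm hL1b.symm
  have T7 := entB_val (X := 1 - 2 * β + β ^ 2) (Y := α ^ 2) (by ring : 1 - 2 * β + β ^ 2 = (1 - β) ^ 2) rfl
    (by ring : 1 - 2 * β + β ^ 2 - α ^ 2 = (1 - α - β) * (1 + α - β)) l1β2 lαα labp
  have T8 := entB_val (X := (1 : ℝ)) (Y := α ^ 2) rfl rfl (by ring : (1 : ℝ) - α ^ 2 = (1 - α) * (1 + α)) l1 lαα l1apa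
  have T9 := entB_val (X := 1 - 2 * β + β ^ 2 - α ^ 2) (Y := α * (1 - α - β))
    (by ring : 1 - 2 * β + β ^ 2 - α ^ 2 = (1 - α - β) * (1 + α - β)) rfl
    (by ring : 1 - 2 * β + β ^ 2 - α ^ 2 - α * (1 - α - β) = (1 - α - β) * (1 - β)) labp lαab lab1b
  have T10 := entB_val (X := β - β ^ 2) (Y := α - α ^ 2 - α * (1 - α - β)) (by ring : β - β ^ 2 = β * (1 - β))
    (by ring : α - α ^ 2 - α * (1 - α - β) = α * β)
    (by ring : β - β ^ 2 - (α - α ^ 2 - α * (1 - α - β)) = β * (1 - α - β)) lβ1β lαβ lβab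
  have T11 := entB_val (X := 1 - α ^ 2) (Y := α - α ^ 2) (by ring : 1 - α ^ 2 = (1 - α) * (1 + α))
    (by ring : α - α ^ 2 = α * (1 - α)) (by ring : 1 - α ^ 2 - (α - α ^ 2) = 1 - α) l1apa lα1α hL1a.symm
  have T12 := entB_val (X := 1 - β - α ^ 2 - α * (1 - α - β)) (Y := α - α ^ 2)
    (by ring : 1 - β - α ^ 2 - α * (1 - α - β) = (1 - α) * (1 - β)) (by ring : α - α ^ 2 = α * (1 - α))
    (by ring : 1 - β - α ^ 2 - α * (1 - α - β) - (α - α ^ 2) = (1 - α) * (1 - α - β)) l1a1b lα1α l1aab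
  have T14 := entB_val (X := 1 - β) (Y := α) rfl rfl (by ring : (1 - β) - α = 1 - α - β) hL1b.symm hLa.symm hLab.symm
  unfold slyRate slyFA slyFB slyPsi1
  rw [T1, T2, T3, T4, T5, T6, T7, T8, T9, T10, T11, T12, T14]
  ring

section Taylor

/-- `|log(1+t) - t + t²/2| ≤ 2|t|³` for `|t| ≤ 1/2` (from Mathlib's `abs_log_sub_add_sum_range_le`).
[folklore] -/
theorem abs_log_one_add_sub_le {t : ℝ} (ht : |t| ≤ 1 / 2) :
    |Real.log (1 + t) - t + t ^ 2 / 2| ≤ 2 * |t| ^ 3 := by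
  have hx : |-t| < 1 := by rw [abs_neg]; linarith
  have h := Real.abs_log_sub_add_sum_range_le hx 2
  simp only [Finset.sum_range_succ, Finset.sum_range_zero, zero_add] at h
  norm_num at h
  have h3 : |t| ^ 3 / (1 - |t|) ≤ 2 * |t| ^ 3 := by
    rw [div_le_iff₀ (by linarith)]
    have := abs_nonneg t
    nlinarith [pow_nonneg this 3]
  have : Real.log (1 + t) - t + t ^ 2 / 2 = -t + t ^ 2 / 2 + Real.log (1 + t) := by ring
  rw [this]
  exact h.trans h3

/-- **Second-order Taylor bound for `u ↦ u log u`**: for `u₀ > 0` and `|Δ| ≤ u₀/2`,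
`|(u₀+Δ) log(u₀+Δ) - [u₀ log u₀ + (1 + log u₀) Δ + Δ²/(2u₀)]| ≤ 4 |Δ|³/u₀²`. [folklore] -/
theorem abs_mul_log_taylor_le {u₀ Δ : ℝ} (hu₀ : 0 < u₀) (hΔ : |Δ| ≤ u₀ / 2) :
    |(u₀ + Δ) * Real.log (u₀ + Δ) -
        (u₀ * Real.log u₀ + (1 + Real.log u₀) * Δ + Δ ^ 2 / (2 * u₀))| ≤ 4 * |Δ| ^ 3 / u₀ ^ 2 := by
  set t : ℝ := Δ / u₀ with ht
  have hΔt : Δ = u₀ * t := by rw [ht]; field_simp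
  have htabs : |t| ≤ 1 / 2 := by
    rw [ht, abs_div, abs_of_pos hu₀, div_le_iff₀ hu₀]; linarith
  have h1t : 0 < 1 + t := by
    have := abs_le.1 htabs; linarith
  have hu : u₀ + Δ = u₀ * (1 + t) := by rw [hΔt]; ring
  have hlog : Real.log (u₀ + Δ) = Real.log u₀ + Real.log (1 + t) := by
    rw [hu, Real.log_mul hu₀.ne' h1t.ne']
  -- the difference is `u₀ · [(1+t) log(1+t) - t - t²/2]`
  have hdiff : (u₀ + Δ) * Real.log (u₀ + Δ) -
      (u₀ * Real.log u₀ + (1 + Real.log u₀) * Δ + Δ ^ 2 / (2 * u₀)) =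
      u₀ * ((1 + t) * Real.log (1 + t) - t - t ^ 2 / 2) := by
    rw [hlog, hu, hΔt]; field_simp; ring
  rw [hdiff, abs_mul, abs_of_pos hu₀]
  -- `|(1+t) log(1+t) - t - t²/2| ≤ 4 |t|³`
  have hr := abs_log_one_add_sub_le htabs
  have hkey : |(1 + t) * Real.log (1 + t) - t - t ^ 2 / 2| ≤ 4 * |t| ^ 3 := by
    have hsplit : (1 + t) * Real.log (1 + t) - t - t ^ 2 / 2 =
        (1 + t) * (Real.log (1 + t) - t + t ^ 2 / 2) - t ^ 3 / 2 := by ring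
    rw [hsplit]
    have h1 : |(1 + t) * (Real.log (1 + t) - t + t ^ 2 / 2)| ≤ 3 / 2 * (2 * |t| ^ 3) := by
      rw [abs_mul]
      have h1t' : |1 + t| ≤ 3 / 2 := by
        rw [abs_le]; have := abs_le.1 htabs; constructor <;> linarith
      exact mul_le_mul h1t' hr (abs_nonneg _) (by norm_num)
    have h2 : |t ^ 3 / 2| = |t| ^ 3 / 2 := by rw [abs_div, abs_pow]; norm_num
    calc |(1 + t) * (Real.log (1 + t) - t + t ^ 2 / 2) - t ^ 3 / 2|
        ≤ |(1 + t) * (Real.log (1 + t) - t + t ^ 2 / 2)| + |t ^ 3 / 2| := abs_sub _ _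
      _ ≤ 3 / 2 * (2 * |t| ^ 3) + |t| ^ 3 / 2 := by rw [h2]; linarith [h1]
      _ ≤ 4 * |t| ^ 3 := by have := pow_nonneg (abs_nonneg t) 3; linarith
  calc u₀ * |(1 + t) * Real.log (1 + t) - t - t ^ 2 / 2| ≤ u₀ * (4 * |t| ^ 3) :=
        mul_le_mul_of_nonneg_left hkey hu₀.le
    _ = 4 * |Δ| ^ 3 / u₀ ^ 2 := by
        rw [hΔt, abs_mul, abs_of_pos hu₀]; field_simp

/-- **Second-order Taylor bound for `entB`**: for `X₀ > Y₀ > 0` and perturbations `x, y` with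
`|x| ≤ X₀/2`, `|y| ≤ Y₀/2`, `|x - y| ≤ (X₀-Y₀)/2`,
`|entB(X₀+x, Y₀+y) - [entB(X₀,Y₀) + (x log X₀ - y log Y₀ - (x-y) log(X₀-Y₀))
   + (x²/(2X₀) - y²/(2Y₀) - (x-y)²/(2(X₀-Y₀)))]| ≤ 4(|x|³/X₀² + |y|³/Y₀² + |x-y|³/(X₀-Y₀)²)`.
[folklore] -/
theorem abs_entB_taylor_le {X₀ Y₀ x y : ℝ} (hY : 0 < Y₀) (hXY : Y₀ < X₀) (hx : |x| ≤ X₀ / 2)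
    (hy : |y| ≤ Y₀ / 2) (hxy : |x - y| ≤ (X₀ - Y₀) / 2) :
    |entB (X₀ + x) (Y₀ + y) - (entB X₀ Y₀ +
        (x * Real.log X₀ - y * Real.log Y₀ - (x - y) * Real.log (X₀ - Y₀)) +
        (x ^ 2 / (2 * X₀) - y ^ 2 / (2 * Y₀) - (x - y) ^ 2 / (2 * (X₀ - Y₀))))| ≤
      4 * (|x| ^ 3 / X₀ ^ 2 + |y| ^ 3 / Y₀ ^ 2 + |x - y| ^ 3 / (X₀ - Y₀) ^ 2) := by
  have hX : 0 < X₀ := hY.trans hXY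
  have hZ : 0 < X₀ - Y₀ := by linarith
  have h1 := abs_mul_log_taylor_le hX hx
  have h2 := abs_mul_log_taylor_le hY hy
  have h3 := abs_mul_log_taylor_le hZ hxy
  have hsplit : entB (X₀ + x) (Y₀ + y) - (entB X₀ Y₀ +
      (x * Real.log X₀ - y * Real.log Y₀ - (x - y) * Real.log (X₀ - Y₀)) +
      (x ^ 2 / (2 * X₀) - y ^ 2 / (2 * Y₀) - (x - y) ^ 2 / (2 * (X₀ - Y₀)))) =
      ((X₀ + x) * Real.log (X₀ + x) - (X₀ * Real.log X₀ + (1 + Real.log X₀) * x + x ^ 2 / (2 * X₀))) -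
      ((Y₀ + y) * Real.log (Y₀ + y) - (Y₀ * Real.log Y₀ + (1 + Real.log Y₀) * y + y ^ 2 / (2 * Y₀))) -
      ((X₀ - Y₀ + (x - y)) * Real.log (X₀ - Y₀ + (x - y)) -
        ((X₀ - Y₀) * Real.log (X₀ - Y₀) + (1 + Real.log (X₀ - Y₀)) * (x - y) + (x - y) ^ 2 / (2 * (X₀ - Y₀)))) := by
    unfold entB
    have : X₀ + x - (Y₀ + y) = X₀ - Y₀ + (x - y) := by ring
    rw [this]
    ring
  rw [hsplit]
  calc _ ≤ |((X₀ + x) * Real.log (X₀ + x) - (X₀ * Real.log X₀ + (1 + Real.log X₀) * x + x ^ 2 / (2 * X₀))) -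
          ((Y₀ + y) * Real.log (Y₀ + y) - (Y₀ * Real.log Y₀ + (1 + Real.log Y₀) * y + y ^ 2 / (2 * Y₀)))| +
        |(X₀ - Y₀ + (x - y)) * Real.log (X₀ - Y₀ + (x - y)) -
          ((X₀ - Y₀) * Real.log (X₀ - Y₀) + (1 + Real.log (X₀ - Y₀)) * (x - y) + (x - y) ^ 2 / (2 * (X₀ - Y₀)))| :=
        abs_sub _ _
    _ ≤ (4 * |x| ^ 3 / X₀ ^ 2 + 4 * |y| ^ 3 / Y₀ ^ 2) + 4 * |x - y| ^ 3 / (X₀ - Y₀) ^ 2 :=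
        add_le_add ((abs_sub _ _).trans (add_le_add h1 h2)) h3
    _ = _ := by ring

/-- `abs_entB_taylor_le` with the first argument unperturbed (`x = 0`). [folklore] -/
theorem abs_entB_taylor_le₀ {X₀ Y₀ y : ℝ} (hY : 0 < Y₀) (hXY : Y₀ < X₀) (hy : |y| ≤ Y₀ / 2)
    (hy' : |y| ≤ (X₀ - Y₀) / 2) :
    |entB X₀ (Y₀ + y) - (entB X₀ Y₀ + (-(y * Real.log Y₀) + y * Real.log (X₀ - Y₀)) +
        (-(y ^ 2 / (2 * Y₀)) - y ^ 2 / (2 * (X₀ - Y₀))))| ≤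
      4 * (|y| ^ 3 / Y₀ ^ 2 + |y| ^ 3 / (X₀ - Y₀) ^ 2) := by
  have h := abs_entB_taylor_le (x := 0) hY hXY (by rw [abs_zero]; linarith) hy
    (by rw [zero_sub, abs_neg]; exact hy')
  have hX : X₀ + 0 = X₀ := add_zero _
  rw [hX] at h
  have e1 : entB X₀ (Y₀ + y) - (entB X₀ Y₀ + (0 * Real.log X₀ - y * Real.log Y₀ - (0 - y) * Real.log (X₀ - Y₀)) +
      (0 ^ 2 / (2 * X₀) - y ^ 2 / (2 * Y₀) - (0 - y) ^ 2 / (2 * (X₀ - Y₀)))) =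
      entB X₀ (Y₀ + y) - (entB X₀ Y₀ + (-(y * Real.log Y₀) + y * Real.log (X₀ - Y₀)) +
        (-(y ^ 2 / (2 * Y₀)) - y ^ 2 / (2 * (X₀ - Y₀)))) := by ring
  have e2 : 4 * (|(0:ℝ)| ^ 3 / X₀ ^ 2 + |y| ^ 3 / Y₀ ^ 2 + |0 - y| ^ 3 / (X₀ - Y₀) ^ 2) =
      4 * (|y| ^ 3 / Y₀ ^ 2 + |y| ^ 3 / (X₀ - Y₀) ^ 2) := by
    rw [abs_zero, zero_sub, abs_neg]; ring
  rw [e1, e2] at h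
  exact h

end Taylor

section Expansion

/-- `|w| ≤ s`, `m² ≤ U`, `m > 0` give `|w|³/U² ≤ s³/m⁴`. [folklore] -/
theorem cube_div_sq_le {w s m U : ℝ} (hm : 0 < m) (hw : |w| ≤ s) (hU : m ^ 2 ≤ U) :
    |w| ^ 3 / U ^ 2 ≤ s ^ 3 / m ^ 4 := by
  have hU0 : 0 < U := lt_of_lt_of_le (by positivity) hU
  rw [div_le_div_iff₀ (by positivity) (by positivity)]
  have h1 : |w| ^ 3 ≤ s ^ 3 := pow_le_pow_left₀ (abs_nonneg _) hw 3
  have h2 : m ^ 4 ≤ U ^ 2 := by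
    have : m ^ 4 = (m ^ 2) ^ 2 := by ring
    rw [this]; exact pow_le_pow_left₀ (by positivity) hU 2
  have hs : 0 ≤ s := (abs_nonneg w).trans hw
  exact mul_le_mul h1 h2 (by positivity) (by positivity)

/-- **The Hessian quadratic form of `f` at the product point** (Mossel–Weitz–Wormald's `H_f`,
printed in the proof of their Theorem 3.3): `slyQ(h) = ½ hᵀ H_f h`, coordinates `(γ, δ, ε)`.
[cite: MosselWeitzWormald2008, proof of Theorem 3.3 (the matrix `H_f`, entries `h₁₁,…,h₃₃`)] -/
noncomputable def slyQ (d : ℕ) (α β h₁ h₂ h₃ : ℝ) : ℝ :=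
  (((α + d - 2) / (α * (α - 1) ^ 2) - (β + d * α) / (α ^ 2 * β) + d / ((1 - α) * (1 - β)) -
        d / (β * (1 - β) * (1 - α - β))) * h₁ ^ 2 +
      (-(1 - α - β + d * α * β) / (β ^ 2 * (1 - β) ^ 2 * (1 - α - β))) * h₂ ^ 2 +
      (-(d * (1 - α - β + 2 * α * β)) / (α * β * (1 - α) * (1 - β) * (1 - α - β))) * h₃ ^ 2 +
      2 * (d / (β * (1 - β) * (1 - α - β))) * h₁ * h₂ +
      2 * (-(d * (1 - α - 2 * β + 2 * α * β + β ^ 2)) / (α * β * (1 - α) * (1 - β) * (1 - α - β))) * h₁ * h₃ +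
      2 * (d / (β * (1 - β) * (1 - α - β))) * h₂ * h₃) / 2

/-- The linear part of the expansion of `f` at the product point (a sum of `11` pieces, one per
non-constant `entB` term of `f`); it vanishes identically (`slyLin_eq_zero`, MWW Lemma 5.1).
[cite: MosselWeitzWormald2008, Lemma 5.1] -/
noncomputable def slyLin (d : ℕ) (α β h₁ h₂ h₃ : ℝ) : ℝ :=
  (-((h₁) * Real.log (α ^ 2)) + (h₁) * Real.log (α - (α ^ 2))) + (-((-h₁) * Real.log (α - α ^ 2)) + (-h₁) * Real.log (1 - α - (α - α ^ 2))) + (-((h₂) * Real.log (β ^ 2)) + (h₂) * Real.log (β - (β ^ 2))) + (-((-h₂) * Real.log (β - β ^ 2)) + (-h₂) * Real.log (1 - β - (β - β ^ 2))) + (d:ℝ) * ((h₂) * Real.log (1 - 2 * β + β ^ 2) - (h₁) * Real.log (α ^ 2) - ((h₂) - (h₁)) * Real.log (1 - 2 * β + β ^ 2 - (α ^ 2))) - (d:ℝ) * (-((h₁) * Real.log (α ^ 2)) + (h₁) * Real.log ((1:ℝ) - (α ^ 2))) + (d:ℝ) * ((h₂ - h₁) * Real.log (1 - 2 * β + β ^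 2 - α ^ 2) - (h₃) * Real.log (α * (1 - α - β)) - ((h₂ - h₁) - (h₃)) * Real.log (1 - 2 * β + β ^ 2 - α ^ 2 - (α * (1 - α - β)))) + (d:ℝ) * ((-h₂) * Real.log (β - β ^ 2) - (-h₁ - h₃) * Real.log (α - α ^ 2 - α * (1 - α - β)) - ((-h₂) - (-h₁ - h₃)) * Real.log (β - β ^ 2 - (α - α ^ 2 - α * (1 - α - β)))) - (d:ℝ) * ((-h₁) * Real.log (1 - α ^ 2) - (-h₁) * Real.log (α - α ^ 2) - ((-h₁) - (-h₁)) * Real.log (1 - α ^ 2 - (α - α ^ 2))) + (d:ℝ) * ((-h₁ - h₃) * Real.log (1 - β - α ^ 2 - α * (1 - α - β)) - (-h₁) * Real.log (α - α ^ 2) - ((-h₁ - h₃) - (-h₁)) * Real.log (1 - β - α ^ 2 - α * (1 - α - β) - (α - α ^ 2))) - (d:ℝ) * (-((-h₁) * Real.log (α - α ^ 2)) + (-h₁) * Real.log (1 - α - (α - α ^ 2)))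

/-- The quadratic part of the expansion of `f` at the product point, in raw form (equal to `slyQ`,
`slyQuad_eq`). [cite: MosselWeitzWormald2008, proof of Theorem 6.11] -/
noncomputable def slyQuad (d : ℕ) (α β h₁ h₂ h₃ : ℝ) : ℝ :=
  (-((h₁) ^ 2 / (2 * (α ^ 2))) - (h₁) ^ 2 / (2 * (α - (α ^ 2)))) + (-((-h₁) ^ 2 / (2 * (α - α ^ 2))) - (-h₁) ^ 2 / (2 * (1 - α - (α - α ^ 2)))) + (-((h₂) ^ 2 / (2 * (β ^ 2))) - (h₂) ^ 2 / (2 * (β - (β ^ 2)))) + (-((-h₂) ^ 2 / (2 * (β - β ^ 2))) - (-h₂) ^ 2 / (2 * (1 - β - (β - β ^ 2)))) + (d:ℝ) * ((h₂) ^ 2 / (2 * (1 - 2 * β + β ^ 2)) - (h₁) ^ 2 / (2 * (α ^ 2)) - ((h₂) - (h₁)) ^ 2 / (2 * (1 - 2 * β + β ^ 2 - (α ^ 2)))) - (d:ℝ) * (-((h₁) ^ 2 / (2 * (α ^ 2))) - (h₁) ^ 2 / (2 * ((1:ℝ) - (α ^ 2)))) + (d:ℝ) * ((h₂ - h₁)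 ^ 2 / (2 * (1 - 2 * β + β ^ 2 - α ^ 2)) - (h₃) ^ 2 / (2 * (α * (1 - α - β))) - ((h₂ - h₁) - (h₃)) ^ 2 / (2 * (1 - 2 * β + β ^ 2 - α ^ 2 - (α * (1 - α - β))))) + (d:ℝ) * ((-h₂) ^ 2 / (2 * (β - β ^ 2)) - (-h₁ - h₃) ^ 2 / (2 * (α - α ^ 2 - α * (1 - α - β))) - ((-h₂) - (-h₁ - h₃)) ^ 2 / (2 * (β - β ^ 2 - (α - α ^ 2 - α * (1 - α - β))))) - (d:ℝ) * ((-h₁) ^ 2 / (2 * (1 - α ^ 2)) - (-h₁) ^ 2 / (2 * (α - α ^ 2)) - ((-h₁) - (-h₁)) ^ 2 / (2 * (1 - α ^ 2 - (α - α ^ 2)))) + (d:ℝ) * ((-h₁ - h₃) ^ 2 / (2 * (1 - β - α ^ 2 - α * (1 - α - β))) - (-h₁) ^ 2 / (2 * (α - α ^ 2)) - ((-h₁ - h₃) - (-h₁)) ^ 2 / (2 * (1 - β - α ^ 2 - α * (1 - α - β) - (α - α ^ 2)))) - (d:ℝ) * (-((-h₁) ^ 2 / (2 * (α - α ^ 2)))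 - (-h₁) ^ 2 / (2 * (1 - α - (α - α ^ 2))))

/-- The third-order remainder of the expansion of `f` at the product point: the signed sum of the
scalar remainders of the `11` non-constant `entB` terms. [folklore] -/
noncomputable def slyErr (d : ℕ) (α β h₁ h₂ h₃ : ℝ) : ℝ :=
  (entB (α) (α ^ 2 + (h₁)) - (entB (α) (α ^ 2) + (-((h₁) * Real.log (α ^ 2)) + (h₁) * Real.log (α - (α ^ 2))) + (-((h₁) ^ 2 / (2 * (α ^ 2))) - (h₁) ^ 2 / (2 * (α - (α ^ 2)))))) + (entB (1 - α) (α - α ^ 2 + (-h₁)) - (entB (1 - α) (α - α ^ 2) + (-((-h₁) * Real.log (α - α ^ 2)) + (-h₁) * Real.log (1 - α - (α - α ^ 2))) + (-((-h₁) ^ 2 / (2 * (α - α ^ 2))) - (-h₁) ^ 2 / (2 * (1 - α - (α - α ^ 2)))))) + (entB (β) (β ^ 2 + (h₂)) - (entB (β) (β ^ 2) + (-((h₂) * Real.log (β ^ 2)) + (h₂) * Real.log (β - (β ^ 2))) + (-((h₂) ^ 2 / (2 * (β ^ 2))) - (h₂) ^ 2 / (2 * (β - (β ^ 2)))))) + (entB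 (1 - β) (β - β ^ 2 + (-h₂)) - (entB (1 - β) (β - β ^ 2) + (-((-h₂) * Real.log (β - β ^ 2)) + (-h₂) * Real.log (1 - β - (β - β ^ 2))) + (-((-h₂) ^ 2 / (2 * (β - β ^ 2))) - (-h₂) ^ 2 / (2 * (1 - β - (β - β ^ 2)))))) + (d:ℝ) * (entB (1 - 2 * β + β ^ 2 + (h₂)) (α ^ 2 + (h₁)) - (entB (1 - 2 * β + β ^ 2) (α ^ 2) + ((h₂) * Real.log (1 - 2 * β + β ^ 2) - (h₁) * Real.log (α ^ 2) - ((h₂) - (h₁)) * Real.log (1 - 2 * β + β ^ 2 - (α ^ 2))) + ((h₂) ^ 2 / (2 * (1 - 2 * β + β ^ 2)) - (h₁) ^ 2 / (2 * (α ^ 2)) - ((h₂) - (h₁)) ^ 2 / (2 * (1 - 2 * β + β ^ 2 - (α ^ 2)))))) - (d:ℝ) * (entB ((1:ℝ)) (α ^ 2 + (h₁)) - (entB ((1:ℝ)) (α ^ 2) + (-((h₁) * Real.log (α ^ 2)) + (h₁) * Real.log ((1:ℝ) - (α ^ 2))) + (-((h₁) ^ 2 / (2 * (α ^ 2))) - (h₁)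 ^ 2 / (2 * ((1:ℝ) - (α ^ 2)))))) + (d:ℝ) * (entB (1 - 2 * β + β ^ 2 - α ^ 2 + (h₂ - h₁)) (α * (1 - α - β) + (h₃)) - (entB (1 - 2 * β + β ^ 2 - α ^ 2) (α * (1 - α - β)) + ((h₂ - h₁) * Real.log (1 - 2 * β + β ^ 2 - α ^ 2) - (h₃) * Real.log (α * (1 - α - β)) - ((h₂ - h₁) - (h₃)) * Real.log (1 - 2 * β + β ^ 2 - α ^ 2 - (α * (1 - α - β)))) + ((h₂ - h₁) ^ 2 / (2 * (1 - 2 * β + β ^ 2 - α ^ 2)) - (h₃) ^ 2 / (2 * (α * (1 - α - β))) - ((h₂ - h₁) - (h₃)) ^ 2 / (2 * (1 - 2 * β + β ^ 2 - α ^ 2 - (α * (1 - α - β))))))) + (d:ℝ) * (entB (β - β ^ 2 + (-h₂)) (α - α ^ 2 - α * (1 - α - β) + (-h₁ - h₃)) - (entB (β - β ^ 2) (α - α ^ 2 - α * (1 - α - β)) + ((-h₂) * Real.log (β - β ^ 2) - (-h₁ - h₃) * Real.log (α - α ^ 2 - α * (1 - α - β)) - ((-h₂) - (-h₁ - h₃))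 * Real.log (β - β ^ 2 - (α - α ^ 2 - α * (1 - α - β)))) + ((-h₂) ^ 2 / (2 * (β - β ^ 2)) - (-h₁ - h₃) ^ 2 / (2 * (α - α ^ 2 - α * (1 - α - β))) - ((-h₂) - (-h₁ - h₃)) ^ 2 / (2 * (β - β ^ 2 - (α - α ^ 2 - α * (1 - α - β))))))) - (d:ℝ) * (entB (1 - α ^ 2 + (-h₁)) (α - α ^ 2 + (-h₁)) - (entB (1 - α ^ 2) (α - α ^ 2) + ((-h₁) * Real.log (1 - α ^ 2) - (-h₁) * Real.log (α - α ^ 2) - ((-h₁) - (-h₁)) * Real.log (1 - α ^ 2 - (α - α ^ 2))) + ((-h₁) ^ 2 / (2 * (1 - α ^ 2)) - (-h₁) ^ 2 / (2 * (α - α ^ 2)) - ((-h₁) - (-h₁)) ^ 2 / (2 * (1 - α ^ 2 - (α - α ^ 2)))))) + (d:ℝ) * (entB (1 - β - α ^ 2 - α * (1 - α - β) + (-h₁ - h₃)) (α - α ^ 2 + (-h₁)) - (entB (1 - β - α ^ 2 - α * (1 - α - β)) (α - α ^ 2) + ((-h₁ - h₃) * Real.log (1 - β - α ^ 2 - α *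 (1 - α - β)) - (-h₁) * Real.log (α - α ^ 2) - ((-h₁ - h₃) - (-h₁)) * Real.log (1 - β - α ^ 2 - α * (1 - α - β) - (α - α ^ 2))) + ((-h₁ - h₃) ^ 2 / (2 * (1 - β - α ^ 2 - α * (1 - α - β))) - (-h₁) ^ 2 / (2 * (α - α ^ 2)) - ((-h₁ - h₃) - (-h₁)) ^ 2 / (2 * (1 - β - α ^ 2 - α * (1 - α - β) - (α - α ^ 2)))))) - (d:ℝ) * (entB (1 - α) (α - α ^ 2 + (-h₁)) - (entB (1 - α) (α - α ^ 2) + (-((-h₁) * Real.log (α - α ^ 2)) + (-h₁) * Real.log (1 - α - (α - α ^ 2))) + (-((-h₁) ^ 2 / (2 * (α - α ^ 2))) - (-h₁) ^ 2 / (2 * (1 - α - (α - α ^ 2))))))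

set_option maxHeartbeats 4000000 in
set_option maxRecDepth 16000 in
/-- **Exact decomposition** `f(c* + h) = f(c*) + slyLin(h) + slyQuad(h) + slyErr(h)`. [folklore] -/
theorem slyRate_decomp (d : ℕ) (α β h₁ h₂ h₃ : ℝ) :
    slyRate d α β (α ^ 2 + h₁) (β ^ 2 + h₂) (α * (1 - α - β) + h₃) =
      slyRate d α β (α ^ 2) (β ^ 2) (α * (1 - α - β)) + slyLin d α β h₁ h₂ h₃ +
        slyQuad d α β h₁ h₂ h₃ + slyErr d α β h₁ h₂ h₃ := by
  have brA2 : entB (1 - α) (α - (α ^ 2 + h₁)) = entB (1 - α) (α - α ^ 2 + (-h₁)) := by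
    congr 1; ring
  have brA5 : entB (1 - β) (β - (β ^ 2 + h₂)) = entB (1 - β) (β - β ^ 2 + (-h₂)) := by
    congr 1; ring
  have brB7 : entB (1 - 2 * β + (β ^ 2 + h₂)) (α ^ 2 + h₁) = entB (1 - 2 * β + β ^ 2 + (h₂)) (α ^ 2 + (h₁)) := by
    congr 1; ring
  have brB9 : entB (1 - 2 * β + (β ^ 2 + h₂) - (α ^ 2 + h₁)) (α * (1 - α - β) + h₃) = entB (1 - 2 * β + β ^ 2 - α ^ 2 + (h₂ - h₁)) (α * (1 - α - β) + (h₃)) := by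
    congr 1; ring
  have brB10 : entB (β - (β ^ 2 + h₂)) (α - (α ^ 2 + h₁) - (α * (1 - α - β) + h₃)) = entB (β - β ^ 2 + (-h₂)) (α - α ^ 2 - α * (1 - α - β) + (-h₁ - h₃)) := by
    congr 1 <;> ring
  have brB11 : entB (1 - (α ^ 2 + h₁)) (α - (α ^ 2 + h₁)) = entB (1 - α ^ 2 + (-h₁)) (α - α ^ 2 + (-h₁)) := by
    congr 1 <;> ring
  have brB12 : entB (1 - β - (α ^ 2 + h₁) - (α * (1 - α - β) + h₃)) (α - (α ^ 2 + h₁)) = entB (1 - β - α ^ 2 - α * (1 - α - β) + (-h₁ - h₃)) (α - α ^ 2 + (-h₁)) := by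
    congr 1 <;> ring
  unfold slyRate slyFA slyFB slyPsi1 slyLin slyQuad slyErr
  rw [brA2, brA5, brB7, brB9, brB10, brB11, brB12]
  ring

set_option maxHeartbeats 4000000 in
set_option maxRecDepth 16000 in
/-- **MWW Lemma 5.1** (the product point is stationary): the linear part vanishes.
[cite: MosselWeitzWormald2008, Lemma 5.1] -/
theorem slyLin_eq_zero (d : ℕ) {α β : ℝ} (hα : 0 < α) (hβ : 0 < β) (hαβ : α + β < 1)
    (h₁ h₂ h₃ : ℝ) : slyLin d α β h₁ h₂ h₃ = 0 := by
  have h1α : 0 < 1 - α := by linarith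
  have h1β : 0 < 1 - β := by linarith
  have hab : 0 < 1 - α - β := by linarith
  have hpa : 0 < 1 + α := by linarith
  have hpab : 0 < 1 + α - β := by linarith
  have lg2 : Real.log (α ^ 2) = 2 * Real.log α := by rw [Real.log_pow]; norm_num
  have lg3 : Real.log (α - (α ^ 2)) = Real.log α + Real.log (1 - α) := by rw [show (α - (α ^ 2) : ℝ) = α * (1 - α) by ring]; exact Real.log_mul hα.ne' h1α.ne'
  have lg5 : Real.log (α - α ^ 2) = Real.log α + Real.log (1 - α) := by rw [show (α - α ^ 2 : ℝ) = α * (1 - α) by ring]; exact Real.log_mul hα.ne' h1α.ne'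
  have lg6 : Real.log (1 - α - (α - α ^ 2)) = 2 * Real.log (1 - α) := by rw [show (1 - α - (α - α ^ 2) : ℝ) = (1 - α) ^ 2 by ring]; rw [Real.log_pow]; norm_num
  have lg8 : Real.log (β ^ 2) = 2 * Real.log β := by rw [Real.log_pow]; norm_num
  have lg9 : Real.log (β - (β ^ 2)) = Real.log β + Real.log (1 - β) := by rw [show (β - (β ^ 2) : ℝ) = β * (1 - β) by ring]; exact Real.log_mul hβ.ne' h1β.ne'
  have lg11 : Real.log (β - β ^ 2) = Real.log β + Real.log (1 - β) := by rw [show (β - β ^ 2 : ℝ) = β * (1 - β) by ring]; exact Real.log_mul hβ.ne' h1β.ne'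
  have lg12 : Real.log (1 - β - (β - β ^ 2)) = 2 * Real.log (1 - β) := by rw [show (1 - β - (β - β ^ 2) : ℝ) = (1 - β) ^ 2 by ring]; rw [Real.log_pow]; norm_num
  have lg13 : Real.log (1 - 2 * β + β ^ 2) = 2 * Real.log (1 - β) := by rw [show (1 - 2 * β + β ^ 2 : ℝ) = (1 - β) ^ 2 by ring]; rw [Real.log_pow]; norm_num
  have lg14 : Real.log (1 - 2 * β + β ^ 2 - (α ^ 2)) = Real.log (1 - α - β) + Real.log (1 + α - β) := by rw [show (1 - 2 * β + β ^ 2 - (α ^ 2) : ℝ) = (1 - α - β) * (1 + α - β) by ring]; exact Real.log_mul hab.ne' hpab.ne'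
  have lg15 : Real.log ((1:ℝ)) = (0:ℝ) := by rw [show ((1:ℝ) : ℝ) = 1 by ring]; exact Real.log_one
  have lg16 : Real.log ((1:ℝ) - (α ^ 2)) = Real.log (1 - α) + Real.log (1 + α) := by rw [show ((1:ℝ) - (α ^ 2) : ℝ) = (1 - α) * (1 + α) by ring]; exact Real.log_mul h1α.ne' hpa.ne'
  have lg17 : Real.log (1 - 2 * β + β ^ 2 - α ^ 2) = Real.log (1 - α - β) + Real.log (1 + α - β) := by rw [show (1 - 2 * β + β ^ 2 - α ^ 2 : ℝ) = (1 - α - β) * (1 + α - β) by ring]; exact Real.log_mul hab.ne' hpab.ne'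
  have lg18 : Real.log (α * (1 - α - β)) = Real.log α + Real.log (1 - α - β) := by exact Real.log_mul hα.ne' hab.ne'
  have lg19 : Real.log (1 - 2 * β + β ^ 2 - α ^ 2 - (α * (1 - α - β))) = Real.log (1 - α - β) + Real.log (1 - β) := by rw [show (1 - 2 * β + β ^ 2 - α ^ 2 - (α * (1 - α - β)) : ℝ) = (1 - α - β) * (1 - β) by ring]; exact Real.log_mul hab.ne' h1β.ne'
  have lg20 : Real.log (α - α ^ 2 - α * (1 - α - β)) = Real.log α + Real.log β := by rw [show (α - α ^ 2 - α * (1 - α - β) : ℝ) = α * β by ring]; exact Real.log_mul hα.ne' hβ.ne'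
  have lg21 : Real.log (β - β ^ 2 - (α - α ^ 2 - α * (1 - α - β))) = Real.log β + Real.log (1 - α - β) := by rw [show (β - β ^ 2 - (α - α ^ 2 - α * (1 - α - β)) : ℝ) = β * (1 - α - β) by ring]; exact Real.log_mul hβ.ne' hab.ne'
  have lg22 : Real.log (1 - α ^ 2) = Real.log (1 - α) + Real.log (1 + α) := by rw [show (1 - α ^ 2 : ℝ) = (1 - α) * (1 + α) by ring]; exact Real.log_mul h1α.ne' hpa.ne'
  have lg23 : Real.log (1 - α ^ 2 - (α - α ^ 2)) = Real.log (1 - α) := by rw [show (1 - α ^ 2 - (α - α ^ 2) : ℝ) = 1 - α by ring]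
  have lg24 : Real.log (1 - β - α ^ 2 - α * (1 - α - β)) = Real.log (1 - α) + Real.log (1 - β) := by rw [show (1 - β - α ^ 2 - α * (1 - α - β) : ℝ) = (1 - α) * (1 - β) by ring]; exact Real.log_mul h1α.ne' h1β.ne'
  have lg25 : Real.log (1 - β - α ^ 2 - α * (1 - α - β) - (α - α ^ 2)) = Real.log (1 - α) + Real.log (1 - α - β) := by rw [show (1 - β - α ^ 2 - α * (1 - α - β) - (α - α ^ 2) : ℝ) = (1 - α) * (1 - α - β) by ring]; exact Real.log_mul h1α.ne' hab.ne'
  unfold slyLin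
  simp only [lg2, lg3, lg6, lg8, lg9, lg12, lg13, lg14, lg16, lg18, lg19, lg20, lg21, lg23, lg24, lg25]
  ring

set_option maxHeartbeats 4000000 in
set_option maxRecDepth 16000 in
/-- The quadratic part is MWW's Hessian form (identification of `H_f`).
[cite: MosselWeitzWormald2008, proof of Theorem 3.3 (the matrix `H_f`)] -/
theorem slyQuad_eq (d : ℕ) {α β : ℝ} (hα : 0 < α) (hβ : 0 < β) (hαβ : α + β < 1) (h₁ h₂ h₃ : ℝ) :
    slyQuad d α β h₁ h₂ h₃ = slyQ d α β h₁ h₂ h₃ := by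
  have h1α : 0 < 1 - α := by linarith
  have h1β : 0 < 1 - β := by linarith
  have hab : 0 < 1 - α - β := by linarith
  have hpa : 0 < 1 + α := by linarith
  have hpab : 0 < 1 + α - β := by linarith
  unfold slyQuad slyQ
  rw [show (1 - β - α ^ 2 - α * (1 - α - β) - (α - α ^ 2) : ℝ) = (1 - α) * (1 - α - β) by ring]
  rw [show (1 - 2 * β + β ^ 2 - α ^ 2 - α * (1 - α - β) : ℝ) = (1 - α - β) * (1 - β) by ring]
  rw [show (β - β ^ 2 - (α - α ^ 2 - α * (1 - α - β)) : ℝ) = β * (1 - α - β) by ring]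
  rw [show (1 - β - α ^ 2 - α * (1 - α - β) : ℝ) = (1 - α) * (1 - β) by ring]
  rw [show (1 - 2 * β + β ^ 2 - α ^ 2 : ℝ) = (1 - α - β) * (1 + α - β) by ring]
  rw [show (α - α ^ 2 - α * (1 - α - β) : ℝ) = α * β by ring]
  rw [show (1 - α ^ 2 - (α - α ^ 2) : ℝ) = 1 - α by ring]
  rw [show (1 - α - (α - α ^ 2) : ℝ) = (1 - α) ^ 2 by ring]
  rw [show (1 - β - (β - β ^ 2) : ℝ) = (1 - β) ^ 2 by ring]
  rw [show (1 - 2 * β + β ^ 2 : ℝ) = (1 - β) ^ 2 by ring]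
  rw [show (1 - α ^ 2 : ℝ) = (1 - α) * (1 + α) by ring]
  rw [show (α - α ^ 2 : ℝ) = α * (1 - α) by ring]
  rw [show (β - β ^ 2 : ℝ) = β * (1 - β) by ring]
  rw [show ((α - 1) ^ 2 : ℝ) = (1 - α) ^ 2 by ring]
  field_simp
  ring

set_option maxHeartbeats 4000000 in
set_option maxRecDepth 16000 in
/-- **The remainder is cubic**: for `s = |h₁|+|h₂|+|h₃| ≤ m²/2`, `m = min(α,β,1-α-β)`,
`|slyErr(h)| ≤ 12(4+7d) s³/m⁴`. [folklore] -/
theorem abs_slyErr_le (d : ℕ) {α β : ℝ} (hα : 0 < α) (hβ : 0 < β) (hαβ : α + β < 1)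
    {h₁ h₂ h₃ m s : ℝ} (hm : m = min (min α β) (1 - α - β)) (hsd : s = |h₁| + |h₂| + |h₃|)
    (hs : s ≤ m ^ 2 / 2) :
    |slyErr d α β h₁ h₂ h₃| ≤ 12 * (4 + 7 * d) * (s ^ 3 / m ^ 4) := by
  have h1α : 0 < 1 - α := by linarith
  have h1β : 0 < 1 - β := by linarith
  have hab : 0 < 1 - α - β := by linarith
  have hpa : 0 < 1 + α := by linarith
  have hpab : 0 < 1 + α - β := by linarith
  -- smallness bookkeeping
  have hm0 : 0 < m := by rw [hm]; exact lt_min (lt_min hα hβ) hab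
  have hmα : m ≤ α := by rw [hm]; exact (min_le_left _ _).trans (min_le_left _ _)
  have hmβ : m ≤ β := by rw [hm]; exact (min_le_left _ _).trans (min_le_right _ _)
  have hmab : m ≤ 1 - α - β := by rw [hm]; exact min_le_right _ _
  have hm1a : m ≤ 1 - α := by linarith
  have hm1b : m ≤ 1 - β := by linarith
  have hmpa : m ≤ 1 + α := by linarith
  have hmpab : m ≤ 1 + α - β := by linarith
  have hm1 : m ≤ 1 := by linarith
  have hs0 : 0 ≤ s := by rw [hsd]; positivity
  have hs1 : |h₁| ≤ s := by rw [hsd]; linarith [abs_nonneg h₂, abs_nonneg h₃]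
  have hs2 : |h₂| ≤ s := by rw [hsd]; linarith [abs_nonneg h₁, abs_nonneg h₃]
  have hs3 : |h₃| ≤ s := by rw [hsd]; linarith [abs_nonneg h₁, abs_nonneg h₂]
  have hs0' : |(0:ℝ)| ≤ s := by rw [abs_zero]; exact hs0
  have hsn1 : |-h₁| ≤ s := by rw [abs_neg]; exact hs1
  have hsn2 : |-h₂| ≤ s := by rw [abs_neg]; exact hs2
  have hsn3 : |-h₃| ≤ s := by rw [abs_neg]; exact hs3
  have hs21 : |h₂ - h₁| ≤ s := by rw [hsd]; have := abs_sub h₂ h₁; linarith [abs_nonneg h₃]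
  have hs13 : |-h₁ - h₃| ≤ s := by
    rw [show -h₁ - h₃ = -(h₁ + h₃) by ring, abs_neg, hsd]; have := abs_add_le h₁ h₃; linarith [abs_nonneg h₂]
  have hs213 : |h₂ - h₁ - h₃| ≤ s := by
    rw [hsd]; have := abs_sub (h₂ - h₁) h₃; have := abs_sub h₂ h₁; linarith
  have hs132 : |h₁ + h₃ - h₂| ≤ s := by
    rw [hsd]; have := abs_sub (h₁ + h₃) h₂; have := abs_add_le h₁ h₃; linarith
  have bd : ∀ {w U : ℝ}, |w| ≤ s → m ^ 2 ≤ U → |w| ≤ U / 2 := fun hw hU => by linarith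
  have hmm : m ^ 2 ≤ m := by rw [sq]; exact mul_le_of_le_one_right hm0.le hm1
  have lo1 : m ^ 2 ≤ α := hmm.trans hmα
  have lo2 : m ^ 2 ≤ α ^ 2 := pow_le_pow_left₀ hm0.le hmα 2
  have lo3 : m ^ 2 ≤ α - (α ^ 2) := by rw [show (α - (α ^ 2) : ℝ) = α * (1 - α) by ring]; exact (by rw [sq]; exact mul_le_mul hmα hm1a hm0.le (hm0.le.trans hmα))
  have lo4 : m ^ 2 ≤ 1 - α := hmm.trans hm1a
  have lo5 : m ^ 2 ≤ α - α ^ 2 := by rw [show (α - α ^ 2 : ℝ) = α * (1 - α) by ring]; exact (by rw [sq]; exact mul_le_mul hmα hm1a hm0.le (hm0.le.trans hmα))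
  have lo6 : m ^ 2 ≤ 1 - α - (α - α ^ 2) := by rw [show (1 - α - (α - α ^ 2) : ℝ) = (1 - α) ^ 2 by ring]; exact pow_le_pow_left₀ hm0.le hm1a 2
  have lo7 : m ^ 2 ≤ β := hmm.trans hmβ
  have lo8 : m ^ 2 ≤ β ^ 2 := pow_le_pow_left₀ hm0.le hmβ 2
  have lo9 : m ^ 2 ≤ β - (β ^ 2) := by rw [show (β - (β ^ 2) : ℝ) = β * (1 - β) by ring]; exact (by rw [sq]; exact mul_le_mul hmβ hm1b hm0.le (hm0.le.trans hmβ))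
  have lo10 : m ^ 2 ≤ 1 - β := hmm.trans hm1b
  have lo11 : m ^ 2 ≤ β - β ^ 2 := by rw [show (β - β ^ 2 : ℝ) = β * (1 - β) by ring]; exact (by rw [sq]; exact mul_le_mul hmβ hm1b hm0.le (hm0.le.trans hmβ))
  have lo12 : m ^ 2 ≤ 1 - β - (β - β ^ 2) := by rw [show (1 - β - (β - β ^ 2) : ℝ) = (1 - β) ^ 2 by ring]; exact pow_le_pow_left₀ hm0.le hm1b 2
  have lo13 : m ^ 2 ≤ 1 - 2 * β + β ^ 2 := by rw [show (1 - 2 * β + β ^ 2 : ℝ) = (1 - β) ^ 2 by ring]; exact pow_le_pow_left₀ hm0.le hm1b 2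
  have lo14 : m ^ 2 ≤ 1 - 2 * β + β ^ 2 - (α ^ 2) := by rw [show (1 - 2 * β + β ^ 2 - (α ^ 2) : ℝ) = (1 - α - β) * (1 + α - β) by ring]; exact (by rw [sq]; exact mul_le_mul hmab hmpab hm0.le (hm0.le.trans hmab))
  have lo15 : m ^ 2 ≤ (1:ℝ) := by rw [show ((1:ℝ) : ℝ) = 1 by ring]; exact hmm.trans hm1
  have lo16 : m ^ 2 ≤ (1:ℝ) - (α ^ 2) := by rw [show ((1:ℝ) - (α ^ 2) : ℝ) = (1 - α) * (1 + α) by ring]; exact (by rw [sq]; exact mul_le_mul hm1a hmpa hm0.le (hm0.le.trans hm1a))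
  have lo17 : m ^ 2 ≤ 1 - 2 * β + β ^ 2 - α ^ 2 := by rw [show (1 - 2 * β + β ^ 2 - α ^ 2 : ℝ) = (1 - α - β) * (1 + α - β) by ring]; exact (by rw [sq]; exact mul_le_mul hmab hmpab hm0.le (hm0.le.trans hmab))
  have lo18 : m ^ 2 ≤ α * (1 - α - β) := (by rw [sq]; exact mul_le_mul hmα hmab hm0.le (hm0.le.trans hmα))
  have lo19 : m ^ 2 ≤ 1 - 2 * β + β ^ 2 - α ^ 2 - (α * (1 - α - β)) := by rw [show (1 - 2 * β + β ^ 2 - α ^ 2 - (α * (1 - α - β)) : ℝ) = (1 - α - β) * (1 - β) by ring]; exact (by rw [sq]; exact mul_le_mul hmab hm1b hm0.le (hm0.le.trans hmab))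
  have lo20 : m ^ 2 ≤ α - α ^ 2 - α * (1 - α - β) := by rw [show (α - α ^ 2 - α * (1 - α - β) : ℝ) = α * β by ring]; exact (by rw [sq]; exact mul_le_mul hmα hmβ hm0.le (hm0.le.trans hmα))
  have lo21 : m ^ 2 ≤ β - β ^ 2 - (α - α ^ 2 - α * (1 - α - β)) := by rw [show (β - β ^ 2 - (α - α ^ 2 - α * (1 - α - β)) : ℝ) = β * (1 - α - β) by ring]; exact (by rw [sq]; exact mul_le_mul hmβ hmab hm0.le (hm0.le.trans hmβ))
  have lo22 : m ^ 2 ≤ 1 - α ^ 2 := by rw [show (1 - α ^ 2 : ℝ) = (1 - α) * (1 + α) by ring]; exact (by rw [sq]; exact mul_le_mul hm1a hmpa hm0.le (hm0.le.trans hm1a))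
  have lo23 : m ^ 2 ≤ 1 - α ^ 2 - (α - α ^ 2) := by rw [show (1 - α ^ 2 - (α - α ^ 2) : ℝ) = 1 - α by ring]; exact hmm.trans hm1a
  have lo24 : m ^ 2 ≤ 1 - β - α ^ 2 - α * (1 - α - β) := by rw [show (1 - β - α ^ 2 - α * (1 - α - β) : ℝ) = (1 - α) * (1 - β) by ring]; exact (by rw [sq]; exact mul_le_mul hm1a hm1b hm0.le (hm0.le.trans hm1a))
  have lo25 : m ^ 2 ≤ 1 - β - α ^ 2 - α * (1 - α - β) - (α - α ^ 2) := by rw [show (1 - β - α ^ 2 - α * (1 - α - β) - (α - α ^ 2) : ℝ) = (1 - α) * (1 - α - β) by ring]; exact (by rw [sq]; exact mul_le_mul hm1a hmab hm0.le (hm0.le.trans hm1a))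
  have EA1 := abs_entB_taylor_le₀ (X₀ := α) (Y₀ := α ^ 2) (y := h₁)
    (lt_of_lt_of_le (by positivity) lo2) (by have := pow_pos hm0 2; linarith [lo3])
    (bd hs1 lo2) (bd hs1 lo3)
  have CA1 : 4 * (|h₁| ^ 3 / (α ^ 2) ^ 2 + |h₁| ^ 3 / (α - (α ^ 2)) ^ 2) ≤ 12 * (s ^ 3 / m ^ 4) := by
    have c2 := cube_div_sq_le hm0 hs1 lo2
    have c3 := cube_div_sq_le hm0 hs1 lo3
    have : 0 ≤ s ^ 3 / m ^ 4 := by positivity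
    linarith
  have EA2 := abs_entB_taylor_le₀ (X₀ := 1 - α) (Y₀ := α - α ^ 2) (y := -h₁)
    (lt_of_lt_of_le (by positivity) lo5) (by have := pow_pos hm0 2; linarith [lo6])
    (bd hsn1 lo5) (bd hsn1 lo6)
  have CA2 : 4 * (|-h₁| ^ 3 / (α - α ^ 2) ^ 2 + |-h₁| ^ 3 / (1 - α - (α - α ^ 2)) ^ 2) ≤ 12 * (s ^ 3 / m ^ 4) := by
    have c2 := cube_div_sq_le hm0 hsn1 lo5
    have c3 := cube_div_sq_le hm0 hsn1 lo6
    have : 0 ≤ s ^ 3 / m ^ 4 := by positivity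
    linarith
  have EA4 := abs_entB_taylor_le₀ (X₀ := β) (Y₀ := β ^ 2) (y := h₂)
    (lt_of_lt_of_le (by positivity) lo8) (by have := pow_pos hm0 2; linarith [lo9])
    (bd hs2 lo8) (bd hs2 lo9)
  have CA4 : 4 * (|h₂| ^ 3 / (β ^ 2) ^ 2 + |h₂| ^ 3 / (β - (β ^ 2)) ^ 2) ≤ 12 * (s ^ 3 / m ^ 4) := by
    have c2 := cube_div_sq_le hm0 hs2 lo8
    have c3 := cube_div_sq_le hm0 hs2 lo9
    have : 0 ≤ s ^ 3 / m ^ 4 := by positivity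
    linarith
  have EA5 := abs_entB_taylor_le₀ (X₀ := 1 - β) (Y₀ := β - β ^ 2) (y := -h₂)
    (lt_of_lt_of_le (by positivity) lo11) (by have := pow_pos hm0 2; linarith [lo12])
    (bd hsn2 lo11) (bd hsn2 lo12)
  have CA5 : 4 * (|-h₂| ^ 3 / (β - β ^ 2) ^ 2 + |-h₂| ^ 3 / (1 - β - (β - β ^ 2)) ^ 2) ≤ 12 * (s ^ 3 / m ^ 4) := by
    have c2 := cube_div_sq_le hm0 hsn2 lo11
    have c3 := cube_div_sq_le hm0 hsn2 lo12
    have : 0 ≤ s ^ 3 / m ^ 4 := by positivity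
    linarith
  have EB7 := abs_entB_taylor_le (X₀ := 1 - 2 * β + β ^ 2) (Y₀ := α ^ 2) (x := h₂) (y := h₁)
    (lt_of_lt_of_le (by positivity) lo2) (by have := pow_pos hm0 2; linarith [lo14])
    (bd hs2 lo13) (bd hs1 lo2)
    (by rw [show ((h₂) - (h₁) : ℝ) = h₂ - h₁ by ring]; exact bd hs21 lo14)
  have CB7 : 4 * (|h₂| ^ 3 / (1 - 2 * β + β ^ 2) ^ 2 + |h₁| ^ 3 / (α ^ 2) ^ 2 + |(h₂) - (h₁)| ^ 3 / (1 - 2 * β + β ^ 2 - (α ^ 2)) ^ 2) ≤ 12 * (s ^ 3 / m ^ 4) := by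
    have c1 := cube_div_sq_le hm0 hs2 lo13
    have c2 := cube_div_sq_le hm0 hs1 lo2
    have c3 : |(h₂) - (h₁)| ^ 3 / (1 - 2 * β + β ^ 2 - (α ^ 2)) ^ 2 ≤ s ^ 3 / m ^ 4 := by
      rw [show ((h₂) - (h₁) : ℝ) = h₂ - h₁ by ring]
      exact cube_div_sq_le hm0 hs21 lo14
    linarith
  have EB8 := abs_entB_taylor_le₀ (X₀ := (1:ℝ)) (Y₀ := α ^ 2) (y := h₁)
    (lt_of_lt_of_le (by positivity) lo2) (by have := pow_pos hm0 2; linarith [lo16])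
    (bd hs1 lo2) (bd hs1 lo16)
  have CB8 : 4 * (|h₁| ^ 3 / (α ^ 2) ^ 2 + |h₁| ^ 3 / ((1:ℝ) - (α ^ 2)) ^ 2) ≤ 12 * (s ^ 3 / m ^ 4) := by
    have c2 := cube_div_sq_le hm0 hs1 lo2
    have c3 := cube_div_sq_le hm0 hs1 lo16
    have : 0 ≤ s ^ 3 / m ^ 4 := by positivity
    linarith
  have EB9 := abs_entB_taylor_le (X₀ := 1 - 2 * β + β ^ 2 - α ^ 2) (Y₀ := α * (1 - α - β)) (x := h₂ - h₁) (y := h₃)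
    (lt_of_lt_of_le (by positivity) lo18) (by have := pow_pos hm0 2; linarith [lo19])
    (bd hs21 lo17) (bd hs3 lo18)
    (by rw [show ((h₂ - h₁) - (h₃) : ℝ) = h₂ - h₁ - h₃ by ring]; exact bd hs213 lo19)
  have CB9 : 4 * (|h₂ - h₁| ^ 3 / (1 - 2 * β + β ^ 2 - α ^ 2) ^ 2 + |h₃| ^ 3 / (α * (1 - α - β)) ^ 2 + |(h₂ - h₁) - (h₃)| ^ 3 / (1 - 2 * β + β ^ 2 - α ^ 2 - (α * (1 - α - β))) ^ 2) ≤ 12 * (s ^ 3 / m ^ 4) := by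
    have c1 := cube_div_sq_le hm0 hs21 lo17
    have c2 := cube_div_sq_le hm0 hs3 lo18
    have c3 : |(h₂ - h₁) - (h₃)| ^ 3 / (1 - 2 * β + β ^ 2 - α ^ 2 - (α * (1 - α - β))) ^ 2 ≤ s ^ 3 / m ^ 4 := by
      rw [show ((h₂ - h₁) - (h₃) : ℝ) = h₂ - h₁ - h₃ by ring]
      exact cube_div_sq_le hm0 hs213 lo19
    linarith
  have EB10 := abs_entB_taylor_le (X₀ := β - β ^ 2) (Y₀ := α - α ^ 2 - α * (1 - α - β)) (x := -h₂) (y := -h₁ - h₃)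
    (lt_of_lt_of_le (by positivity) lo20) (by have := pow_pos hm0 2; linarith [lo21])
    (bd hsn2 lo11) (bd hs13 lo20)
    (by rw [show ((-h₂) - (-h₁ - h₃) : ℝ) = h₁ + h₃ - h₂ by ring]; exact bd hs132 lo21)
  have CB10 : 4 * (|-h₂| ^ 3 / (β - β ^ 2) ^ 2 + |-h₁ - h₃| ^ 3 / (α - α ^ 2 - α * (1 - α - β)) ^ 2 + |(-h₂) - (-h₁ - h₃)| ^ 3 / (β - β ^ 2 - (α - α ^ 2 - α * (1 - α - β))) ^ 2) ≤ 12 * (s ^ 3 / m ^ 4) := by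
    have c1 := cube_div_sq_le hm0 hsn2 lo11
    have c2 := cube_div_sq_le hm0 hs13 lo20
    have c3 : |(-h₂) - (-h₁ - h₃)| ^ 3 / (β - β ^ 2 - (α - α ^ 2 - α * (1 - α - β))) ^ 2 ≤ s ^ 3 / m ^ 4 := by
      rw [show ((-h₂) - (-h₁ - h₃) : ℝ) = h₁ + h₃ - h₂ by ring]
      exact cube_div_sq_le hm0 hs132 lo21
    linarith
  have EB11 := abs_entB_taylor_le (X₀ := 1 - α ^ 2) (Y₀ := α - α ^ 2) (x := -h₁) (y := -h₁)
    (lt_of_lt_of_le (by positivity) lo5) (by have := pow_pos hm0 2; linarith [lo23])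
    (bd hsn1 lo22) (bd hsn1 lo5)
    (by rw [show ((-h₁) - (-h₁) : ℝ) = (0:ℝ) by ring]; exact bd hs0' lo23)
  have CB11 : 4 * (|-h₁| ^ 3 / (1 - α ^ 2) ^ 2 + |-h₁| ^ 3 / (α - α ^ 2) ^ 2 + |(-h₁) - (-h₁)| ^ 3 / (1 - α ^ 2 - (α - α ^ 2)) ^ 2) ≤ 12 * (s ^ 3 / m ^ 4) := by
    have c1 := cube_div_sq_le hm0 hsn1 lo22
    have c2 := cube_div_sq_le hm0 hsn1 lo5
    have c3 : |(-h₁) - (-h₁)| ^ 3 / (1 - α ^ 2 - (α - α ^ 2)) ^ 2 ≤ s ^ 3 / m ^ 4 := by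
      rw [show ((-h₁) - (-h₁) : ℝ) = (0:ℝ) by ring]
      exact cube_div_sq_le hm0 hs0' lo23
    linarith
  have EB12 := abs_entB_taylor_le (X₀ := 1 - β - α ^ 2 - α * (1 - α - β)) (Y₀ := α - α ^ 2) (x := -h₁ - h₃) (y := -h₁)
    (lt_of_lt_of_le (by positivity) lo5) (by have := pow_pos hm0 2; linarith [lo25])
    (bd hs13 lo24) (bd hsn1 lo5)
    (by rw [show ((-h₁ - h₃) - (-h₁) : ℝ) = -h₃ by ring]; exact bd hsn3 lo25)
  have CB12 : 4 * (|-h₁ - h₃| ^ 3 / (1 - β - α ^ 2 - α * (1 - α - β)) ^ 2 + |-h₁| ^ 3 / (α - α ^ 2) ^ 2 + |(-h₁ - h₃) - (-h₁)| ^ 3 / (1 - β - α ^ 2 - α * (1 - α - β) - (α - α ^ 2)) ^ 2) ≤ 12 * (s ^ 3 / m ^ 4) := by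
    have c1 := cube_div_sq_le hm0 hs13 lo24
    have c2 := cube_div_sq_le hm0 hsn1 lo5
    have c3 : |(-h₁ - h₃) - (-h₁)| ^ 3 / (1 - β - α ^ 2 - α * (1 - α - β) - (α - α ^ 2)) ^ 2 ≤ s ^ 3 / m ^ 4 := by
      rw [show ((-h₁ - h₃) - (-h₁) : ℝ) = -h₃ by ring]
      exact cube_div_sq_le hm0 hsn3 lo25
    linarith
  have EB13 := abs_entB_taylor_le₀ (X₀ := 1 - α) (Y₀ := α - α ^ 2) (y := -h₁)
    (lt_of_lt_of_le (by positivity) lo5) (by have := pow_pos hm0 2; linarith [lo6])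
    (bd hsn1 lo5) (bd hsn1 lo6)
  have CB13 : 4 * (|-h₁| ^ 3 / (α - α ^ 2) ^ 2 + |-h₁| ^ 3 / (1 - α - (α - α ^ 2)) ^ 2) ≤ 12 * (s ^ 3 / m ^ 4) := by
    have c2 := cube_div_sq_le hm0 hsn1 lo5
    have c3 := cube_div_sq_le hm0 hsn1 lo6
    have : 0 ≤ s ^ 3 / m ^ 4 := by positivity
    linarith
  have hd0 : (0:ℝ) ≤ d := Nat.cast_nonneg d
  have abA1 := abs_le.1 (EA1)
  have abA2 := abs_le.1 (EA2)
  have abA4 := abs_le.1 (EA4)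
  have abA5 := abs_le.1 (EA5)
  have abB7 := abs_le.1 (EB7)
  have mCB7 := mul_le_mul_of_nonneg_left CB7 hd0
  have mbB7 : -((d:ℝ) * (4 * (|h₂| ^ 3 / (1 - 2 * β + β ^ 2) ^ 2 + |h₁| ^ 3 / (α ^ 2) ^ 2 + |(h₂) - (h₁)| ^ 3 / (1 - 2 * β + β ^ 2 - (α ^ 2)) ^ 2))) ≤ (d:ℝ) * (entB (1 - 2 * β + β ^ 2 + (h₂)) (α ^ 2 + (h₁)) - (entB (1 - 2 * β + β ^ 2) (α ^ 2) + ((h₂) * Real.log (1 - 2 * β + β ^ 2) - (h₁) * Real.log (α ^ 2) - ((h₂) - (h₁)) * Real.log (1 - 2 * β + β ^ 2 - (α ^ 2))) + ((h₂) ^ 2 / (2 * (1 - 2 * β + β ^ 2)) - (h₁) ^ 2 / (2 * (α ^ 2)) - ((h₂) - (h₁)) ^ 2 / (2 * (1 - 2 * β + β ^ 2 - (α ^ 2)))))) ∧ (d:ℝ) * (entB (1 - 2 * β + β ^ 2 + (h₂)) (α ^ 2 + (h₁)) - (entB (1 - 2 * β + β ^ 2) (α ^ 2) + ((h₂) * Real.log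 (1 - 2 * β + β ^ 2) - (h₁) * Real.log (α ^ 2) - ((h₂) - (h₁)) * Real.log (1 - 2 * β + β ^ 2 - (α ^ 2))) + ((h₂) ^ 2 / (2 * (1 - 2 * β + β ^ 2)) - (h₁) ^ 2 / (2 * (α ^ 2)) - ((h₂) - (h₁)) ^ 2 / (2 * (1 - 2 * β + β ^ 2 - (α ^ 2)))))) ≤ (d:ℝ) * (4 * (|h₂| ^ 3 / (1 - 2 * β + β ^ 2) ^ 2 + |h₁| ^ 3 / (α ^ 2) ^ 2 + |(h₂) - (h₁)| ^ 3 / (1 - 2 * β + β ^ 2 - (α ^ 2)) ^ 2)) := by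
    constructor
    · have := mul_le_mul_of_nonneg_left abB7.1 hd0; linarith
    · exact mul_le_mul_of_nonneg_left abB7.2 hd0
  have abB8 := abs_le.1 (EB8)
  have mCB8 := mul_le_mul_of_nonneg_left CB8 hd0
  have mbB8 : -((d:ℝ) * (4 * (|h₁| ^ 3 / (α ^ 2) ^ 2 + |h₁| ^ 3 / ((1:ℝ) - (α ^ 2)) ^ 2))) ≤ (d:ℝ) * (entB ((1:ℝ)) (α ^ 2 + (h₁)) - (entB ((1:ℝ)) (α ^ 2) + (-((h₁) * Real.log (α ^ 2)) + (h₁) * Real.log ((1:ℝ) - (α ^ 2))) + (-((h₁) ^ 2 / (2 * (α ^ 2))) - (h₁) ^ 2 / (2 * ((1:ℝ) - (α ^ 2)))))) ∧ (d:ℝ) * (entB ((1:ℝ)) (α ^ 2 + (h₁)) - (entB ((1:ℝ)) (α ^ 2) + (-((h₁) * Real.log (α ^ 2)) + (h₁) * Real.log ((1:ℝ) - (α ^ 2))) + (-((h₁) ^ 2 / (2 * (α ^ 2))) - (h₁) ^ 2 / (2 * ((1:ℝ) - (α ^ 2)))))) ≤ (d:ℝ) * (4 * (|h₁| ^ 3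 / (α ^ 2) ^ 2 + |h₁| ^ 3 / ((1:ℝ) - (α ^ 2)) ^ 2)) := by
    constructor
    · have := mul_le_mul_of_nonneg_left abB8.1 hd0; linarith
    · exact mul_le_mul_of_nonneg_left abB8.2 hd0
  have abB9 := abs_le.1 (EB9)
  have mCB9 := mul_le_mul_of_nonneg_left CB9 hd0
  have mbB9 : -((d:ℝ) * (4 * (|h₂ - h₁| ^ 3 / (1 - 2 * β + β ^ 2 - α ^ 2) ^ 2 + |h₃| ^ 3 / (α * (1 - α - β)) ^ 2 + |(h₂ - h₁) - (h₃)| ^ 3 / (1 - 2 * β + β ^ 2 - α ^ 2 - (α * (1 - α - β))) ^ 2))) ≤ (d:ℝ) * (entB (1 - 2 * β + β ^ 2 - α ^ 2 + (h₂ - h₁)) (α * (1 - α - β) + (h₃)) - (entB (1 - 2 * β + β ^ 2 - α ^ 2) (α * (1 - α - β)) + ((h₂ - h₁) * Real.log (1 - 2 * β + β ^ 2 - α ^ 2) - (h₃) * Real.log (α * (1 - α - β)) - ((h₂ - h₁) - (h₃)) * Real.log (1 - 2 * β + β ^ 2 - α ^ 2 - (α * (1 - α - β)))) + ((h₂ -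 h₁) ^ 2 / (2 * (1 - 2 * β + β ^ 2 - α ^ 2)) - (h₃) ^ 2 / (2 * (α * (1 - α - β))) - ((h₂ - h₁) - (h₃)) ^ 2 / (2 * (1 - 2 * β + β ^ 2 - α ^ 2 - (α * (1 - α - β))))))) ∧ (d:ℝ) * (entB (1 - 2 * β + β ^ 2 - α ^ 2 + (h₂ - h₁)) (α * (1 - α - β) + (h₃)) - (entB (1 - 2 * β + β ^ 2 - α ^ 2) (α * (1 - α - β)) + ((h₂ - h₁) * Real.log (1 - 2 * β + β ^ 2 - α ^ 2) - (h₃) * Real.log (α * (1 - α - β)) - ((h₂ - h₁) - (h₃)) * Real.log (1 - 2 * β + β ^ 2 - α ^ 2 - (α * (1 - α - β)))) + ((h₂ - h₁) ^ 2 / (2 * (1 - 2 * β + β ^ 2 - α ^ 2)) - (h₃) ^ 2 / (2 * (α * (1 - α - β))) - ((h₂ - h₁) - (h₃)) ^ 2 / (2 * (1 - 2 * β + β ^ 2 - α ^ 2 - (α * (1 - α - β))))))) ≤ (d:ℝ) * (4 * (|h₂ - h₁| ^ 3 / (1 - 2 * β + β ^ 2 - α ^ 2) ^ 2 + |h₃|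 ^ 3 / (α * (1 - α - β)) ^ 2 + |(h₂ - h₁) - (h₃)| ^ 3 / (1 - 2 * β + β ^ 2 - α ^ 2 - (α * (1 - α - β))) ^ 2)) := by
    constructor
    · have := mul_le_mul_of_nonneg_left abB9.1 hd0; linarith
    · exact mul_le_mul_of_nonneg_left abB9.2 hd0
  have abB10 := abs_le.1 (EB10)
  have mCB10 := mul_le_mul_of_nonneg_left CB10 hd0
  have mbB10 : -((d:ℝ) * (4 * (|-h₂| ^ 3 / (β - β ^ 2) ^ 2 + |-h₁ - h₃| ^ 3 / (α - α ^ 2 - α * (1 - α - β)) ^ 2 + |(-h₂) - (-h₁ - h₃)| ^ 3 / (β - β ^ 2 - (α - α ^ 2 - α * (1 - α - β))) ^ 2))) ≤ (d:ℝ) * (entB (β - β ^ 2 + (-h₂)) (α - α ^ 2 - α * (1 - α - β) + (-h₁ - h₃)) - (entB (β - β ^ 2) (α - α ^ 2 - α * (1 - α - β)) + ((-h₂) * Real.log (β - β ^ 2) - (-h₁ - h₃) * Real.log (α - α ^ 2 - α * (1 - α - β)) - ((-h₂) - (-h₁ - h₃)) * Real.log (β - β ^ 2 - (α - α ^ 2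 - α * (1 - α - β)))) + ((-h₂) ^ 2 / (2 * (β - β ^ 2)) - (-h₁ - h₃) ^ 2 / (2 * (α - α ^ 2 - α * (1 - α - β))) - ((-h₂) - (-h₁ - h₃)) ^ 2 / (2 * (β - β ^ 2 - (α - α ^ 2 - α * (1 - α - β))))))) ∧ (d:ℝ) * (entB (β - β ^ 2 + (-h₂)) (α - α ^ 2 - α * (1 - α - β) + (-h₁ - h₃)) - (entB (β - β ^ 2) (α - α ^ 2 - α * (1 - α - β)) + ((-h₂) * Real.log (β - β ^ 2) - (-h₁ - h₃) * Real.log (α - α ^ 2 - α * (1 - α - β)) - ((-h₂) - (-h₁ - h₃)) * Real.log (β - β ^ 2 - (α - α ^ 2 - α * (1 - α - β)))) + ((-h₂) ^ 2 / (2 * (β - β ^ 2)) - (-h₁ - h₃) ^ 2 / (2 * (α - α ^ 2 - α * (1 - α - β))) - ((-h₂) - (-h₁ - h₃)) ^ 2 / (2 * (β - β ^ 2 - (α - α ^ 2 - α * (1 - α - β))))))) ≤ (d:ℝ) * (4 * (|-h₂| ^ 3 / (β - β ^ 2) ^ 2 + |-h₁ - h₃| ^ 3 / (α - α ^ 2 -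 α * (1 - α - β)) ^ 2 + |(-h₂) - (-h₁ - h₃)| ^ 3 / (β - β ^ 2 - (α - α ^ 2 - α * (1 - α - β))) ^ 2)) := by
    constructor
    · have := mul_le_mul_of_nonneg_left abB10.1 hd0; linarith
    · exact mul_le_mul_of_nonneg_left abB10.2 hd0
  have abB11 := abs_le.1 (EB11)
  have mCB11 := mul_le_mul_of_nonneg_left CB11 hd0
  have mbB11 : -((d:ℝ) * (4 * (|-h₁| ^ 3 / (1 - α ^ 2) ^ 2 + |-h₁| ^ 3 / (α - α ^ 2) ^ 2 + |(-h₁) - (-h₁)| ^ 3 / (1 - α ^ 2 - (α - α ^ 2)) ^ 2))) ≤ (d:ℝ) * (entB (1 - α ^ 2 + (-h₁)) (α - α ^ 2 + (-h₁)) - (entB (1 - α ^ 2) (α - α ^ 2) + ((-h₁) * Real.log (1 - α ^ 2) - (-h₁) * Real.log (α - α ^ 2) - ((-h₁) - (-h₁)) * Real.log (1 - α ^ 2 - (α - α ^ 2))) + ((-h₁) ^ 2 / (2 * (1 - α ^ 2)) - (-h₁) ^ 2 / (2 * (α - α ^ 2)) - ((-h₁) - (-h₁)) ^ 2 / (2 *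 (1 - α ^ 2 - (α - α ^ 2)))))) ∧ (d:ℝ) * (entB (1 - α ^ 2 + (-h₁)) (α - α ^ 2 + (-h₁)) - (entB (1 - α ^ 2) (α - α ^ 2) + ((-h₁) * Real.log (1 - α ^ 2) - (-h₁) * Real.log (α - α ^ 2) - ((-h₁) - (-h₁)) * Real.log (1 - α ^ 2 - (α - α ^ 2))) + ((-h₁) ^ 2 / (2 * (1 - α ^ 2)) - (-h₁) ^ 2 / (2 * (α - α ^ 2)) - ((-h₁) - (-h₁)) ^ 2 / (2 * (1 - α ^ 2 - (α - α ^ 2)))))) ≤ (d:ℝ) * (4 * (|-h₁| ^ 3 / (1 - α ^ 2) ^ 2 + |-h₁| ^ 3 / (α - α ^ 2) ^ 2 + |(-h₁) - (-h₁)| ^ 3 / (1 - α ^ 2 - (α - α ^ 2)) ^ 2)) := by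
    constructor
    · have := mul_le_mul_of_nonneg_left abB11.1 hd0; linarith
    · exact mul_le_mul_of_nonneg_left abB11.2 hd0
  have abB12 := abs_le.1 (EB12)
  have mCB12 := mul_le_mul_of_nonneg_left CB12 hd0
  have mbB12 : -((d:ℝ) * (4 * (|-h₁ - h₃| ^ 3 / (1 - β - α ^ 2 - α * (1 - α - β)) ^ 2 + |-h₁| ^ 3 / (α - α ^ 2) ^ 2 + |(-h₁ - h₃) - (-h₁)| ^ 3 / (1 - β - α ^ 2 - α * (1 - α - β) - (α - α ^ 2)) ^ 2))) ≤ (d:ℝ) * (entB (1 - β - α ^ 2 - α * (1 - α - β) + (-h₁ - h₃)) (α - α ^ 2 + (-h₁)) - (entB (1 - β - α ^ 2 - α * (1 - α - β)) (α - α ^ 2) + ((-h₁ - h₃) * Real.log (1 - β - α ^ 2 - α * (1 - α - β)) - (-h₁) * Real.log (α - α ^ 2) - ((-h₁ - h₃) - (-h₁)) * Real.log (1 - β - α ^ 2 - α * (1 - α - β) - (α - α ^ 2))) + ((-h₁ - h₃) ^ 2 / (2 * (1 - β - α ^ 2 - α * (1 - α - β))) - (-h₁) ^ 2 / (2 * (α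 - α ^ 2)) - ((-h₁ - h₃) - (-h₁)) ^ 2 / (2 * (1 - β - α ^ 2 - α * (1 - α - β) - (α - α ^ 2)))))) ∧ (d:ℝ) * (entB (1 - β - α ^ 2 - α * (1 - α - β) + (-h₁ - h₃)) (α - α ^ 2 + (-h₁)) - (entB (1 - β - α ^ 2 - α * (1 - α - β)) (α - α ^ 2) + ((-h₁ - h₃) * Real.log (1 - β - α ^ 2 - α * (1 - α - β)) - (-h₁) * Real.log (α - α ^ 2) - ((-h₁ - h₃) - (-h₁)) * Real.log (1 - β - α ^ 2 - α * (1 - α - β) - (α - α ^ 2))) + ((-h₁ - h₃) ^ 2 / (2 * (1 - β - α ^ 2 - α * (1 - α - β))) - (-h₁) ^ 2 / (2 * (α - α ^ 2)) - ((-h₁ - h₃) - (-h₁)) ^ 2 / (2 * (1 - β - α ^ 2 - α * (1 - α - β) - (α - α ^ 2)))))) ≤ (d:ℝ) * (4 * (|-h₁ - h₃| ^ 3 / (1 - β - α ^ 2 - α * (1 - α - β)) ^ 2 + |-h₁| ^ 3 / (α - α ^ 2) ^ 2 + |(-h₁ - h₃) - (-h₁)| ^ 3 / (1 - β - α ^ 2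 - α * (1 - α - β) - (α - α ^ 2)) ^ 2)) := by
    constructor
    · have := mul_le_mul_of_nonneg_left abB12.1 hd0; linarith
    · exact mul_le_mul_of_nonneg_left abB12.2 hd0
  have abB13 := abs_le.1 (EB13)
  have mCB13 := mul_le_mul_of_nonneg_left CB13 hd0
  have mbB13 : -((d:ℝ) * (4 * (|-h₁| ^ 3 / (α - α ^ 2) ^ 2 + |-h₁| ^ 3 / (1 - α - (α - α ^ 2)) ^ 2))) ≤ (d:ℝ) * (entB (1 - α) (α - α ^ 2 + (-h₁)) - (entB (1 - α) (α - α ^ 2) + (-((-h₁) * Real.log (α - α ^ 2)) + (-h₁) * Real.log (1 - α - (α - α ^ 2))) + (-((-h₁) ^ 2 / (2 * (α - α ^ 2))) - (-h₁) ^ 2 / (2 * (1 - α - (α - α ^ 2)))))) ∧ (d:ℝ) * (entB (1 - α) (α - α ^ 2 + (-h₁)) - (entB (1 - α) (α - α ^ 2) + (-((-h₁) * Real.log (α - α ^ 2)) + (-h₁) * Real.log (1 - α - (α - α ^ 2))) + (-((-h₁) ^ 2 / (2 * (α - α ^ 2))) - (-h₁) ^ 2 / (2 * (1 - α - (α - α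 ^ 2)))))) ≤ (d:ℝ) * (4 * (|-h₁| ^ 3 / (α - α ^ 2) ^ 2 + |-h₁| ^ 3 / (1 - α - (α - α ^ 2)) ^ 2)) := by
    constructor
    · have := mul_le_mul_of_nonneg_left abB13.1 hd0; linarith
    · exact mul_le_mul_of_nonneg_left abB13.2 hd0
  unfold slyErr
  rw [abs_le]
  constructor
  · linarith [abA1.1, abA2.1, abA4.1, abA5.1, mbB7.1, mbB8.1, mbB9.1, mbB10.1, mbB11.1, mbB12.1, mbB13.1, CA1, CA2, CA4, CA5, CB7, CB8, CB9, CB10, CB11, CB12, CB13, mCB7, mCB8, mCB9, mCB10, mCB11, mCB12, mCB13]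
  · linarith [abA1.2, abA2.2, abA4.2, abA5.2, mbB7.2, mbB8.2, mbB9.2, mbB10.2, mbB11.2, mbB12.2, mbB13.2, CA1, CA2, CA4, CA5, CB7, CB8, CB9, CB10, CB11, CB12, CB13, mCB7, mCB8, mCB9, mCB10, mCB11, mCB12, mCB13]

/-- **Second-order expansion of the rate at the product point** (MWW: "the quadratic behaviour of
the function `f` around the stationary point"): for `s = |h₁|+|h₂|+|h₃| ≤ m²/2`,
`m = min(α, β, 1-α-β)`, `|f(α,β; α²+h₁, β²+h₂, α(1-α-β)+h₃) - slyQ(h)| ≤ 12(4 + 7d) s³/m⁴`.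
[cite: MosselWeitzWormald2008, Lemmas 5.1–5.2 and proof of Theorem 6.11/3.3 (`H_f`)] -/
theorem abs_slyRate_sub_slyQ_le (d : ℕ) {α β : ℝ} (hα : 0 < α) (hβ : 0 < β) (hαβ : α + β < 1)
    {h₁ h₂ h₃ m s : ℝ} (hm : m = min (min α β) (1 - α - β)) (hsd : s = |h₁| + |h₂| + |h₃|)
    (hs : s ≤ m ^ 2 / 2) :
    |slyRate d α β (α ^ 2 + h₁) (β ^ 2 + h₂) (α * (1 - α - β) + h₃) - slyQ d α β h₁ h₂ h₃| ≤
      12 * (4 + 7 * d) * (s ^ 3 / m ^ 4) := by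
  rw [slyRate_decomp, slyRate_star d hα hβ hαβ, slyLin_eq_zero d hα hβ hαβ, slyQuad_eq d hα hβ hαβ,
    show (0 : ℝ) + 0 + slyQ d α β h₁ h₂ h₃ + slyErr d α β h₁ h₂ h₃ - slyQ d α β h₁ h₂ h₃ =
      slyErr d α β h₁ h₂ h₃ by ring]
  exact abs_slyErr_le d hα hβ hαβ hm hsd hs

end Expansion

end Literature.Computability.Complexity
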